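import Mathlib.ModelTheory.Satisfiability
import Mathlib.Computability.Encoding
import Literature.Computability.Complexity.TimeBounds
import Literature.Computability.MetaComplexity.BoundedArithSyntax
import Literature.Computability.MetaComplexity.BoundedArithTheories
import HarnessLib

-- provenance: harness21/H21/H21/Statements/PNP/BoundedArithmetic.lean @ f7e0a8e (interim HEAD d8f2665); M5 mechanical rewrite
/-!
# P vs NP: bounded arithmetic (family `pnp`, statement **pnp.S38**; trunk CplxMeta, tier L)

The bounded-arithmetic facts consumed by the "walls" of the `pnp` family (independence /
unprovability results are always relative to Buss's theories `S₂ⁱ`, `T₂ⁱ`):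

* **pnp.S38** `buss_witnessing` — Buss's Main Theorem: a function `f : ℕ → ℕ` is
  `Σᵇ₁`-definable in `S₂¹` iff it is polynomial-time computable (`FP`)
  [Buss, *Bounded Arithmetic*, Bibliopolis 1986, Ch. 5, Main Theorem (Thm. 5.6 / Cor.);
  Krajíček, *Bounded Arithmetic, Propositional Logic and Complexity Theory*, CUP 1995,
  Thm. 7.2.3 (witnessing) and Thm. 6.1.2 / §5.2 (every polytime function is `Σᵇ₁`-definable
  in `S₂¹`)];
* `S2_extends_to_T2` (`i ≥ 1`), `T2_extends_to_S2_succ` — the chain `S₂ⁱ ⊆ T₂ⁱ ⊆ S₂ⁱ⁺¹`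
  [Buss 1986, Thm. 2.6 and §2.6, Cor. 2.16; Krajíček 1995, Lemma 5.2.5, Thm. 5.2.7];
* `S2_succ_isConservativeOver_T2` — `S₂ⁱ⁺¹` is `∀Σᵇᵢ₊₁`-conservative over `T₂ⁱ` (`i ≥ 1`)
  [Buss, *Axiomatizations and conservation results for fragments of bounded arithmetic*,
  in: Logic and Computation, Contemp. Math. 106 (1990), 57–84, Main Theorem;
  Krajíček 1995, Thm. 7.2.4 / Cor. 7.2.6];
* `T2EqS2Succ` — the hypothesis "`T₂ⁱ = S₂ⁱ⁺¹`" of the Krajíček–Pudlák–Takeuti collapse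
  theorem, recorded as a `Prop` (optional item, no inventory id; the polynomial-hierarchy
  consequence is left as a remark, see below).

## Sources

* S. Buss, *Bounded Arithmetic*, Bibliopolis 1986: Ch. 2 (theories, `S₂ⁱ ⊆ T₂ⁱ ⊆ S₂ⁱ⁺¹`),
  Ch. 5 (Main Theorem: `Σᵇ₁`-definable functions of `S₂¹` = `FP`).
* S. Buss, *Axiomatizations and conservation results for fragments of bounded arithmetic*,
  Contemp. Math. 106, AMS 1990.
* J. Krajíček, P. Pudlák, G. Takeuti, *Bounded arithmetic and the polynomial hierarchy*,
  Ann. Pure Appl. Logic 52 (1991), 143–153.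
* J. Krajíček, *Bounded Arithmetic, Propositional Logic and Complexity Theory*, CUP 1995,
  Ch. 5–7.

## Mathlib / H21 anchors (verified by grep)

* Provability is Mathlib's semantic consequence `Theory.ModelsBoundedFormula` (`T ⊨ᵇ φ`,
  `Mathlib/ModelTheory/Satisfiability.lean`), as fixed in outline D3; by completeness it agrees
  with first-order provability.
* Binary notation for `ℕ` is Mathlib's `Computability.encodeNat : ℕ → List Bool`
  (`Mathlib/Computability/Encoding.lean`); `FP` on `ℕ → ℕ` is
  `Literature.CplxCore.PolyTimeComputable encodeNat encodeNat f` (Prop wrapper of Mathlib's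
  `Turing.TM2ComputableInPolyTime`).
* Theories `S2 i`, `T2 i`, `IsSigmabDefinable`, `IsForallSigmab`, `Theory.Extends`,
  `Theory.IsConservativeOver` are from `Literature.Prelude.CplxMeta.BoundedArith{Syntax,Theories}`.
  Mathlib has no bounded arithmetic (grep `Bounded[Aa]rith|PIND|witnessing` in
  `Mathlib/ModelTheory`, `Mathlib/Computability`: nothing).

## Design choices

* `buss_witnessing` is stated for unary `f : ℕ → ℕ` only, matching `IsSigmabDefinable`;
  the `k`-ary Main Theorem reduces to this by Buss's `Σᵇ₁`-definable (and polynomial-time)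
  tupling `⟨x₁,…,xₖ⟩` (Buss 1986, §2.5), which we document rather than formalise. The two
  directions are also recorded separately (`polyTimeComputable_of_isSigmabDefinable_S2_one`,
  the witnessing direction, and `isSigmabDefinable_S2_one_of_polyTimeComputable`).
* `Theory.Extends` is axiom-wise (`∀ φ ∈ T₁, T₂ ⊨ᵇ φ`), so `(S2 i).Extends (T2 i)` says exactly
  "`T₂ⁱ` proves every `Σᵇᵢ-PIND` axiom (and `BASIC`)", and `(T2 i).Extends (S2 (i+1))` says
  "`S₂ⁱ⁺¹` proves every `Σᵇᵢ-IND` axiom" — Buss's two derivations. The prelude file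
  `BoundedArithTheories` already records these as `S2_extends_T2`, `T2_extends_S2_succ`
  (sorried there); the present statements re-export them under the names fixed by the outline
  and are proved *from* them, so no new `sorry` is introduced for the inclusions. Following the
  prelude (and Buss 1986, Thm. 2.6, which is stated for `i ≥ 1`), `S2_extends_to_T2` carries the
  hypothesis `1 ≤ i`; the sharply bounded case `T₂⁰ ⊢ Σᵇ₀-PIND` is not claimed.
* API corollaries are named in Mathlib theorem style
  (`isSigmabDefinable_T2_of_isSigmabDefinable_S2`, …) inside `Literature.PNP` rather than as
  dot-notation extensions of `Literature.Computability.MetaComplexity.IsSigmabDefinable`.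
* Conservativity is stated for `1 ≤ i` as in Buss 1990 (the case `i = 0` is a different and
  later result of Jeřábek 2006 and is not claimed).
* KPT (1991), Buss (1995), Zambella (1996): if `T₂ⁱ = S₂ⁱ⁺¹` (i.e. `T2EqS2Succ i`) for some
  `i ≥ 1` then `Σᵖᵢ₊₁ ⊆ Δᵖᵢ₊₁/poly` and the polynomial hierarchy collapses (to `B(Σᵖᵢ₊₁)`, even
  provably in `T₂ⁱ`). Stating this precisely needs advice versions of the levels of `PH`, which
  the accepted `CplxCore` prelude does not provide; per the outline it is left as this remark.
-/

namespace Literature.Computability.Complexity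

open _root_.Computability FirstOrder FirstOrder.Language MetaComplexity

/-! ## Buss's Main Theorem (witnessing) -/

/-- **pnp.S38** (Buss's Main Theorem / witnessing theorem for `S₂¹`; Buss, *Bounded
Arithmetic* (1986), Ch. 5, Main Theorem; Krajíček 1995, Thm. 7.2.3 with §5.2–6.1).
A function `f : ℕ → ℕ` is `Σᵇ₁`-definable in `S₂¹` — there is a `Σᵇ₁` formula `φ(x, y)`
defining the graph of `f` in `ℕ` with `S₂¹ ⊢ ∀ x ∃ y φ(x, y)` and
`S₂¹ ⊢ ∀ x y y' (φ(x, y) → φ(x, y') → y = y')` — if and only if `f` is computable in polynomial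
time on binary notation (`f ∈ FP`, here `PolyTimeComputable encodeNat encodeNat f` over
Mathlib's TM2 model and binary encoding `Computability.encodeNat`). Provability is semantic
consequence `⊨ᵇ` (equivalent by completeness). Stated for unary functions; the `k`-ary version
of Buss's theorem reduces to this one via the `Σᵇ₁`-definable polynomial-time tupling function
of Buss 1986, §2.5. [cite: Buss1986, §2.5] -/
def buss_witnessing : Prop :=
  ∀ (f : ℕ → ℕ),
    IsSigmabDefinable (S2 1) 1 f ↔ PolyTimeComputable encodeNat encodeNat f

/-- The witnessing direction of Buss's Main Theorem: every function `Σᵇ₁`-definable in `S₂¹`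
is polynomial-time computable (Buss 1986, Ch. 5, Main Theorem; Krajíček 1995,
Thm. 7.2.3). Immediate from `buss_witnessing`. [cite: Buss1986, Ch. 5  Main Theorem] -/
def polyTimeComputable_of_isSigmabDefinable_S2_one : Prop :=
  ∀ {f : ℕ → ℕ} (hf : IsSigmabDefinable (S2 1) 1 f),
    PolyTimeComputable encodeNat encodeNat f

/- interim proof relied on results that are now named facts (D-0014); demoted to a fact by the M5 import, proof preserved:
:=
  (buss_witnessing f).1 hf
-/

/-- The easy direction of Buss's Main Theorem: every polynomial-time computable function
`f : ℕ → ℕ` is `Σᵇ₁`-definable in `S₂¹` (Buss 1986, Ch. 5, Main Theorem, easy direction: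
"every `□ᵖ₁` function is `Σᵇ₁`-definable in `S₂¹`"; Krajíček 1995, §6.1). Immediate from
`buss_witnessing`. [cite: Buss1986, Ch. 5  Main Theorem  easy direction: "ev] -/
def isSigmabDefinable_S2_one_of_polyTimeComputable : Prop :=
  ∀ {f : ℕ → ℕ} (hf : PolyTimeComputable encodeNat encodeNat f),
    IsSigmabDefinable (S2 1) 1 f

/- interim proof relied on results that are now named facts (D-0014); demoted to a fact by the M5 import, proof preserved:
:=
  (buss_witnessing f).2 hf
-/

/-- Polynomial-time functions are `Σᵇ₁`-definable in every `S₂ⁱ`, `i ≥ 1` (Buss 1986, Ch. 5;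
from `buss_witnessing` and monotonicity `S₂¹ ⊆ S₂ⁱ`). [cite: Buss1986, Ch. 5] -/
def isSigmabDefinable_S2_of_polyTimeComputable : Prop :=
  ∀ {f : ℕ → ℕ} {i : ℕ} (hi : 1 ≤ i) (hf : PolyTimeComputable encodeNat encodeNat f),
    IsSigmabDefinable (S2 i) 1 f

/- interim proof relied on results that are now named facts (D-0014); demoted to a fact by the M5 import, proof preserved:
:=
  (isSigmabDefinable_S2_one_of_polyTimeComputable hf).mono_subset (S2_mono hi)
-/

/-! ## The chain `S₂ⁱ ⊆ T₂ⁱ ⊆ S₂ⁱ⁺¹` -/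

/-- `T₂ⁱ` extends `S₂ⁱ` for `i ≥ 1` (`S₂ⁱ ⊆ T₂ⁱ` consequence-wise): `T₂ⁱ` proves every axiom
of `S₂ⁱ`, i.e. `Σᵇᵢ-IND` yields `Σᵇᵢ-PIND` over `BASIC` (Buss 1986, Thm. 2.6 and its corollary
`S₂ⁱ ⊆ T₂ⁱ`, both for `i ≥ 1`; Krajíček 1995, Lemma 5.2.5). With the axiom-wise
`Theory.Extends` this is literally `∀ φ ∈ S₂ⁱ, T₂ⁱ ⊨ᵇ φ`. The case `i = 0` is not a theorem of
the cited sources and is not claimed (as in the prelude). This is the prelude statement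
`Literature.Computability.MetaComplexity.S2_extends_T2` re-exported under the name the `pnp` walls consume. [cite: Buss1986, Thm. 2.6 and its corollary  S₂ⁱ ⊆ T₂ⁱ] -/
def S2_extends_to_T2 : Prop :=
  ∀ {i : ℕ} (hi : 1 ≤ i),
    (S2 i).Extends (T2 i)

/- interim proof relied on results that are now named facts (D-0014); demoted to a fact by the M5 import, proof preserved:
:=
  S2_extends_T2 hi
-/

/-- `S₂ⁱ⁺¹` extends `T₂ⁱ` (`T₂ⁱ ⊆ S₂ⁱ⁺¹` consequence-wise): `S₂ⁱ⁺¹` proves every `Σᵇᵢ-IND`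
axiom, since `Σᵇᵢ-IND` follows from `Σᵇᵢ₊₁-PIND` over `BASIC` (Buss 1986, §2.6, Cor. 2.16;
Buss 1990, §1; Krajíček 1995, Thm. 5.2.7). This is the prelude statement
`Literature.Computability.MetaComplexity.T2_extends_S2_succ` re-exported under the name the `pnp` walls consume. [cite: Buss1986, §2.6  Cor. 2.16] -/
def T2_extends_to_S2_succ : Prop :=
  ∀ (i : ℕ),
    (T2 i).Extends (S2 (i + 1))

/- interim proof relied on results that are now named facts (D-0014); demoted to a fact by the M5 import, proof preserved:
:=
  T2_extends_S2_succ i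
-/

/-- `T₂ⁱ⁺¹` extends `S₂ⁱ⁺¹` for every `i` (successor form of `S2_extends_to_T2`; Buss 1986,
Thm. 2.6; Krajíček 1995, Lemma 5.2.5). [cite: Buss1986, Thm. 2.6] -/
def S2_succ_extends_to_T2_succ : Prop :=
  ∀ (i : ℕ),
    (S2 (i + 1)).Extends (T2 (i + 1))

/- interim proof relied on results that are now named facts (D-0014); demoted to a fact by the M5 import, proof preserved:
:=
  S2_extends_to_T2 (Nat.succ_pos i)
-/

/-- `S₂ⁱ⁺¹` extends `S₂ⁱ` (Buss 1986, §2.4; axiom-wise inclusion `S2_mono`). [cite: Buss1986, §2.4] -/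
def S2_extends_to_S2_succ : Prop :=
  ∀ (i : ℕ),
    (S2 i).Extends (S2 (i + 1))

/- interim proof relied on results that are now named facts (D-0014); demoted to a fact by the M5 import, proof preserved:
:=
  Theory.Extends.of_subset (S2_mono (Nat.le_succ i))
-/

/-- `T₂ⁱ⁺¹` extends `T₂ⁱ` (Buss 1986, §2.4; from `T2_mono`). [cite: Buss1986, §2.4] -/
def T2_extends_to_T2_succ : Prop :=
  ∀ (i : ℕ),
    (T2 i).Extends (T2 (i + 1))

/- interim proof relied on results that are now named facts (D-0014); demoted to a fact by the M5 import, proof preserved: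
:=
  Theory.Extends.of_subset (T2_mono (Nat.le_succ i))
-/

/-- Every consequence of `S₂ⁱ` is a consequence of `T₂ⁱ`, `i ≥ 1` (Buss 1986, Thm. 2.6). [cite: Buss1986, Thm. 2.6] -/
def models_T2_of_models_S2 : Prop :=
  ∀ {i : ℕ} (hi : 1 ≤ i) {φ : Language.boundedArith.Sentence} (h : S2 i ⊨ᵇ φ),
    T2 i ⊨ᵇ φ

/- interim proof relied on results that are now named facts (D-0014); demoted to a fact by the M5 import, proof preserved:
:=
  (S2_extends_to_T2 hi).models h
-/

/-- Every consequence of `T₂ⁱ` is a consequence of `S₂ⁱ⁺¹` (Buss 1986, §2.6). [cite: Buss1986, §2.6] -/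
def models_S2_succ_of_models_T2 : Prop :=
  ∀ {i : ℕ} {φ : Language.boundedArith.Sentence} (h : T2 i ⊨ᵇ φ),
    S2 (i + 1) ⊨ᵇ φ

/- interim proof relied on results that are now named facts (D-0014); demoted to a fact by the M5 import, proof preserved:
:=
  (T2_extends_to_S2_succ i).models h
-/

/-- A function `Σᵇⱼ`-definable in `S₂ⁱ`, `i ≥ 1`, is `Σᵇⱼ`-definable in `T₂ⁱ` (Buss 1986,
Thm. 2.6 with Ch. 5). [cite: Buss1986, Thm. 2.6 with Ch. 5] -/
def isSigmabDefinable_T2_of_isSigmabDefinable_S2 : Prop :=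
  ∀ {i j : ℕ} (hi : 1 ≤ i) {f : ℕ → ℕ} (hf : IsSigmabDefinable (S2 i) j f),
    IsSigmabDefinable (T2 i) j f

/- interim proof relied on results that are now named facts (D-0014); demoted to a fact by the M5 import, proof preserved:
:=
  hf.mono_theory (S2_extends_to_T2 hi)
-/

/-- A function `Σᵇⱼ`-definable in `T₂ⁱ` is `Σᵇⱼ`-definable in `S₂ⁱ⁺¹` (Buss 1986, §2.6,
Cor. 2.16 with Ch. 5). [cite: Buss1986, §2.6  Cor. 2.16 with Ch. 5] -/
def isSigmabDefinable_S2_succ_of_isSigmabDefinable_T2 : Prop :=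
  ∀ {i j : ℕ} {f : ℕ → ℕ} (hf : IsSigmabDefinable (T2 i) j f),
    IsSigmabDefinable (S2 (i + 1)) j f

/- interim proof relied on results that are now named facts (D-0014); demoted to a fact by the M5 import, proof preserved:
:=
  hf.mono_theory (T2_extends_to_S2_succ i)
-/

/-! ## Buss's conservation theorem -/

/-- Buss's conservation theorem: for `i ≥ 1`, `S₂ⁱ⁺¹` is `∀Σᵇᵢ₊₁`-conservative over `T₂ⁱ`,
i.e. every `∀Σᵇᵢ₊₁` sentence provable in `S₂ⁱ⁺¹` is already provable in `T₂ⁱ`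
(Buss, *Axiomatizations and conservation results for fragments of bounded arithmetic*,
Contemp. Math. 106 (1990), Main Theorem; Krajíček 1995, Thm. 7.2.4 / Cor. 7.2.6). The case
`i = 0` is not claimed here. [cite: BussContempMath1990, Main Theorem] [cite: Krajicek1995, Thm. 7.2.4 and Cor. 7.2.6] -/
def S2_succ_isConservativeOver_T2 : Prop :=
  ∀ {i : ℕ} (hi : 1 ≤ i),
    (S2 (i + 1)).IsConservativeOver (T2 i) {φ | IsForallSigmab (i + 1) φ}

/-- For `i ≥ 1` and a `∀Σᵇᵢ₊₁` sentence `φ`, provability in `S₂ⁱ⁺¹` and in `T₂ⁱ` coincide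
(Buss 1990, Main Theorem, combined with `T₂ⁱ ⊆ S₂ⁱ⁺¹`). [cite: BussContempMath1990, Main Theorem  combined with  T₂ⁱ ⊆ S₂ⁱ⁺¹] -/
def models_S2_succ_iff_models_T2 : Prop :=
  ∀ {i : ℕ} (hi : 1 ≤ i) {φ : Language.boundedArith.Sentence} (hφ : IsForallSigmab (i + 1) φ),
    S2 (i + 1) ⊨ᵇ φ ↔ T2 i ⊨ᵇ φ

/- interim proof relied on results that are now named facts (D-0014); demoted to a fact by the M5 import, proof preserved:
:=
  (S2_succ_isConservativeOver_T2 hi).models_iff (T2_extends_to_S2_succ i) hφ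
-/

/-! ## The KPT hypothesis `T₂ⁱ = S₂ⁱ⁺¹` (optional, no inventory id) -/

/-- The hypothesis `T₂ⁱ = S₂ⁱ⁺¹` of the Krajíček–Pudlák–Takeuti theorem, as a `Prop`: `T₂ⁱ`
proves every axiom of `S₂ⁱ⁺¹`, i.e. `T₂ⁱ ⊢ Σᵇᵢ₊₁-PIND` (the converse inclusion
`T2_extends_to_S2_succ` always holds). KPT (Ann. Pure Appl. Logic 52 (1991), Thm.) show that
`T2EqS2Succ i` for some `i ≥ 1` implies `Σᵖᵢ₊₁ ⊆ Δᵖᵢ₊₁/poly`, whence the polynomial hierarchy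
collapses (Buss 1995; Zambella 1996: to `B(Σᵖᵢ₊₁)`); hence if `S₂` is finitely axiomatisable
then `PH` collapses (KPT 1991, Cor. of the Main Theorem). This complexity-theoretic consequence is recorded here only as a remark
(optional item of the outline; it needs advice classes `Σᵖₖ/poly` not available in the
prelude). It is an open problem whether `T2EqS2Succ i` holds for any `i`. [cite: KPT1991, Cor. of the Main Theorem] -/
def T2EqS2Succ (i : ℕ) : Prop :=
  (S2 (i + 1)).Extends (T2 i)

/-- Under `T₂ⁱ = S₂ⁱ⁺¹` the two theories have the same consequences (KPT 1991, §1; immediate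
from the two extensions). [cite: KPT1991, §1] -/
def models_T2_iff_models_S2_succ_of_t2EqS2Succ : Prop :=
  ∀ {i : ℕ} (h : T2EqS2Succ i) (φ : Language.boundedArith.Sentence),
    T2 i ⊨ᵇ φ ↔ S2 (i + 1) ⊨ᵇ φ

/- interim proof relied on results that are now named facts (D-0014); demoted to a fact by the M5 import, proof preserved:
:=
  ⟨(T2_extends_to_S2_succ i).models, h.models⟩
-/

/-- Under `T₂ⁱ = S₂ⁱ⁺¹`, the whole hierarchy above collapses axiom-wise one step:
`S₂ⁱ⁺¹`-consequences are `T₂ⁱ`-consequences, so in particular every function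
`Σᵇⱼ`-definable in `S₂ⁱ⁺¹` is already `Σᵇⱼ`-definable in `T₂ⁱ` (KPT 1991, §1). [cite: KPT1991, §1] -/
theorem isSigmabDefinable_T2_of_S2_succ_of_t2EqS2Succ {i j : ℕ} {f : ℕ → ℕ}
    (h : T2EqS2Succ i) (hf : IsSigmabDefinable (S2 (i + 1)) j f) :
    IsSigmabDefinable (T2 i) j f :=
  hf.mono_theory h

end Literature.Computability.Complexity
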